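import Literature.NumberTheory.EllipticCurves.KubotaLeopoldtTwoNumerator
import Summits.BirchSwinnertonDyer.BirchSwinnertonDyer.Theorems.EisensteinDepletionAtTwoStarStabCoeffBoundary
import Summits.BirchSwinnertonDyer.BirchSwinnertonDyer.Theorems.EisensteinDepletionAtTwoStarGlueLemmas
import Summits.BirchSwinnertonDyer.BirchSwinnertonDyer.Theorems.EisensteinDepletionAtTwoStarCoreReduction
import HarnessLib

/-!
# Route `EisensteinDepletionAtTwo`, crux E1M `DepletedLambdaLawAtTwoMod` (item stmt-BirchSwinnertonDyer-20341),
# line `star`, Eisenstein half — §E₁: the LEVEL ELEMENT `L_Λ = ∑_{t ∣ N} c_t χ₋₄(t) (1+T)^{−f_t} ∈ Λ` and its reduction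
# `red L_Λ = red((1+T)^e)·∏_{ℓ ∣ N} red(γ_ℓ − 1)^{ord_ℓ N}`, `e = −∑_ℓ ord_ℓ(N)·f_ℓ`

Cell `bsd-rank2`, seat `bsd-rank2-eng-2` GEN 8. THEOREMS ONLY — no definition, no named fact, no `sorry`. HONEST FRAMING: `Λ`-bookkeeping
modulo `2` for the Euler-type level factor of the transform of the smoothed Eisenstein–Dedekind measure (lit GEN 20's
`distributionTransform_smoothedEisensteinDedekindTwo`): it is an Euler product over the primes of `N` (`…StarStabCoeff` §A) whose
local factors `1 − (β_ℓ/ℓ)χ₋₄(ℓ)γ_ℓ⁻¹` (`ℓ ∥ N`) and `1 − ((1+ℓ)/ℓ)χ₋₄(ℓ)γ_ℓ⁻¹ + (1/ℓ)γ_ℓ⁻²` (`ℓ² ∥ N`) reduce to `γ̄_ℓ⁻¹(γ̄_ℓ − 1)` and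
`(γ̄_ℓ⁻¹(γ̄_ℓ − 1))²` in `𝔽₂⟦T⟧` (`−β_ℓ/ℓ`, `1/ℓ`, `χ₋₄(ℓ)` are `2`-adic units, `(1+ℓ)/ℓ` is not, `2 = 0`). Input of (★-EisFin)
(evidence #39 on the item). Nothing here reads an analytic rank; (★)/E1M are NOT proved; BSD is not proved by any of this
(PARTITION D-0054: none — r_an ≥ 2 axis S0, door T-r3₂).

* helpers: `iwasawaToPowerSeries_binomialSeries`, `frobeniusExponent_mul_of_odd` / `_one` / `_pow_of_odd` (`f` is additive on odd
  integers: tree `CyclotomicZp.ell_mul`), `binomialSeries_nsmul`, `binomialSeries_finset_sum`, `chiMinusFour_pow`, `residue_eq_of_norm`,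
  `residue_chiMinusFour_of_odd`, `neg_eq_self_powerSeries_residueField_two`, `red_add'`.
* **`red_localLevelFactor`**, **`red_levelElement`**.

References: R. Greenberg, V. Vatsal, Invent. Math. 142 (2000), §1 p. 9, §3 (28) [GreenbergVatsal2000]; G. Stevens, *Arithmetic on
Modular Curves* (1982), §5.4 (PDF p. 74) [Stevens1982]; L. Washington, GTM 83, §7.2 [Washington1997].
-/

set_option linter.dupNamespace false
set_option autoImplicit false

noncomputable section

open scoped Classical

namespace Summit.BirchSwinnertonDyer.BirchSwinnertonDyer.Theorems.DepletionAtTwo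

section LevelFactor

variable {N : ℕ} {β : ℕ → ℕ}

open Literature.NumberTheory.EllipticCurves Literature.NumberTheory.EllipticCurves.GreenbergVatsal2000
  Literature.NumberTheory.EllipticCurves.CyclotomicZp Filter Topology
  Summit.BirchSwinnertonDyer.Rank1Residual.X1.MuLambda

/-- `ι((1+T)^r) = (1+T)^r`: the inclusion `Λ ↪ ℚ₂⟦T⟧` maps Mathlib's binomial series over `ℤ₂` to the one over `ℚ₂`.
[folklore] -/
theorem iwasawaToPowerSeries_binomialSeries (r : ℤ_[2]) :
    iwasawaToPowerSeries 2 (PowerSeries.binomialSeries ℤ_[2] r) = PowerSeries.binomialSeries ℚ_[2] r := by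
  ext n
  rw [iwasawaToPowerSeries, PowerSeries.coeff_map, PowerSeries.binomialSeries_coeff,
    PowerSeries.binomialSeries_coeff, smul_eq_mul, mul_one, Algebra.smul_def, mul_one]

/-- An odd natural number is a unit of `ℤ₂`. [folklore] -/
theorem isUnit_natCast_of_odd {t : ℕ} (ht : Odd t) : IsUnit (t : ℤ_[2]) :=
  PadicInt.isUnit_iff.mpr (PadicInt.norm_natCast_eq_one_iff.mpr (Nat.coprime_two_left.mpr ht))

/-- **`f_{mn} = f_m + f_n` for odd `m, n`** (`γ_cyc^{f_x} = ⟨x⟩` is a homomorphism on `ℤ₂^×`: tree `CyclotomicZp.ell_mul`).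
[cite: GreenbergVatsal2000, §1 p. 9 (definition of f_ℓ)] -/
theorem frobeniusExponent_mul_of_odd {m n : ℕ} (hm : Odd m) (hn : Odd n) :
    frobeniusExponent 2 ((m * n : ℕ) : ℤ_[2]) = frobeniusExponent 2 (m : ℤ_[2]) + frobeniusExponent 2 (n : ℤ_[2]) := by
  have hm' := isUnit_natCast_of_odd hm
  have hn' := isUnit_natCast_of_odd hn
  rw [Nat.cast_mul, frobeniusExponent_of_isUnit (hm'.mul hn'), IsUnit.unit_mul hm' hn', ell_mul,
    ← frobeniusExponent_of_isUnit hm', ← frobeniusExponent_of_isUnit hn']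

/-- `f_1 = 0`. [cite: GreenbergVatsal2000, §1 p. 9 (definition of f_ℓ)] -/
theorem frobeniusExponent_one : frobeniusExponent 2 ((1 : ℕ) : ℤ_[2]) = 0 := by
  rw [Nat.cast_one, frobeniusExponent_of_isUnit isUnit_one, IsUnit.unit_one, ell_one]

/-- `f_{ℓ^j} = j·f_ℓ` for odd `ℓ`. [cite: GreenbergVatsal2000, §1 p. 9 (definition of f_ℓ)] -/
theorem frobeniusExponent_pow_of_odd {ℓ : ℕ} (hℓ : Odd ℓ) (j : ℕ) :
    frobeniusExponent 2 ((ℓ ^ j : ℕ) : ℤ_[2]) = j • frobeniusExponent 2 (ℓ : ℤ_[2]) := by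
  induction j with
  | zero => rw [pow_zero, frobeniusExponent_one, zero_smul]
  | succ j ih => rw [pow_succ, frobeniusExponent_mul_of_odd (hℓ.pow) hℓ, ih, succ_nsmul]

/-- `(1+T)^{j·r} = ((1+T)^r)^j`. [folklore] -/
theorem binomialSeries_nsmul {A : Type*} [CommRing A] [Algebra ℤ_[2] A] (r : ℤ_[2]) (j : ℕ) :
    PowerSeries.binomialSeries A (j • r) = PowerSeries.binomialSeries A r ^ j := by
  induction j with
  | zero => rw [zero_smul, PowerSeries.binomialSeries_zero, pow_zero]
  | succ j ih => rw [succ_nsmul, PowerSeries.binomialSeries_add, ih, pow_succ]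

/-- `(1+T)^{∑ r_i} = ∏ (1+T)^{r_i}`. [folklore] -/
theorem binomialSeries_finset_sum {A : Type*} [CommRing A] [Algebra ℤ_[2] A] {ι : Type*} (s : Finset ι)
    (r : ι → ℤ_[2]) :
    PowerSeries.binomialSeries A (∑ i ∈ s, r i) = ∏ i ∈ s, PowerSeries.binomialSeries A (r i) := by
  classical
  induction s using Finset.induction_on with
  | empty => rw [Finset.sum_empty, Finset.prod_empty, PowerSeries.binomialSeries_zero]
  | insert i s hi ih => rw [Finset.sum_insert hi, Finset.prod_insert hi, PowerSeries.binomialSeries_add, ih]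

/-- `χ₋₄(ℓ^j) = χ₋₄(ℓ)^j`. [folklore] -/
theorem chiMinusFour_pow (ℓ j : ℕ) : chiMinusFour 2 (ℓ ^ j) = chiMinusFour 2 ℓ ^ j := by
  induction j with
  | zero => rw [pow_zero, pow_zero, chiMinusFour_eq_ite]; norm_num
  | succ j ih => rw [pow_succ, chiMinusFour_mul, ih, pow_succ]

/-- The residue of `x ∈ ℤ₂` with `‖x‖ = 1` is `1`, with `‖x‖ < 1` is `0` (`𝔽₂ = {0, 1}`). [folklore] -/
theorem residue_eq_of_norm (x : ℤ_[2]) :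
    (‖x‖ = 1 → IsLocalRing.residue ℤ_[2] x = 1) ∧ (‖x‖ < 1 → IsLocalRing.residue ℤ_[2] x = 0) := by
  refine ⟨fun h ↦ ?_, fun h ↦ ?_⟩
  · have hu := PadicInt.isUnit_iff.mpr h
    rw [← hu.unit_spec]
    exact residue_units_eq_one_two hu.unit
  · rw [IsLocalRing.residue_eq_zero_iff]
    exact PadicInt.mem_nonunits.mpr h

/-- `χ₋₄(ℓ)` is a unit of `ℤ₂` for odd `ℓ`, so its residue is `1`. [folklore] -/
theorem residue_chiMinusFour_of_odd {ℓ : ℕ} (hℓ : Odd ℓ) (j : ℕ) :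
    IsLocalRing.residue ℤ_[2] (chiMinusFour 2 ℓ ^ j) = 1 := by
  have h : ‖chiMinusFour 2 ℓ‖ = 1 := by
    rw [chiMinusFour_eq_ite]
    have : ℓ % 4 = 1 ∨ ℓ % 4 = 3 := by rcases hℓ with ⟨k, rfl⟩; omega
    rcases this with h1 | h3
    · rw [if_pos h1, norm_one]
    · rw [if_neg (by omega), if_pos h3, norm_neg, norm_one]
  rw [map_pow, (residue_eq_of_norm _).1 h, one_pow]

/-- `2 = 0`, hence `−x = x`, in `𝔽₂⟦T⟧`. [folklore] -/
theorem neg_eq_self_powerSeries_residueField_two (x : PowerSeries (IsLocalRing.ResidueField ℤ_[2])) : -x = x := by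
  have h : x + x = 0 := by rw [← two_mul, two_eq_zero_powerSeries_residueField_two, zero_mul]
  exact (neg_eq_of_add_eq_zero_left h)

/-- The stabilisation coefficient `c_t` as an element of `ℤ₂` (odd level). [cite: Stevens1982, §2.4 (PDF pp. 35–37)] -/
theorem exists_padicInt_stabCoeff (hodd : Odd N) (t : ℕ) :
    ∃ z : ℤ_[2], (z : ℚ_[2]) = ((stabCoeff N β t : ℚ) : ℚ_[2]) :=
  ⟨⟨_, norm_stabCoeff_le_one hodd t⟩, rfl⟩

/-- `red(g + h) = red g + red h` (`red` is a ring map). [folklore] -/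
theorem red_add' {p : ℕ} [Fact p.Prime] (g h : IwasawaAlgebra p) : red (g + h) = red g + red h := by
  unfold red
  rw [map_add]

/-- **Reduction mod 2 of the local factors of the level element.** For an odd prime `ℓ` of `N` with exponent
`e_ℓ ∈ {1, 2}` and admissible `β`, the local factor `∑_{j ≤ e_ℓ} C(c_ℓ(j)·χ₋₄(ℓ)^j)·(1+T)^{−j f_ℓ}` of the level element reduces to
`(red((1+T)^{−f_ℓ}) · red(γ_ℓ − 1))^{e_ℓ}` in `𝔽₂⟦T⟧`: `−β_ℓ/ℓ` and `1/ℓ` are `2`-adic units (residue `1`), `−(1+ℓ)/ℓ` is not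
(residue `0`), `χ₋₄(ℓ) = ±1`, and `2 = 0`. [cite: GreenbergVatsal2000, §3 (28)] [cite: Stevens1982, §5.4 (PDF p. 74)] -/
theorem red_localLevelFactor (hodd : Odd N) (hadm : IsAdmissibleStabData N β) {ℓ : ℕ} (hℓ : ℓ ∈ N.primeFactors)
    (z : ℕ → ℤ_[2]) (hz : ∀ j, (z j : ℚ_[2]) = ((localStabCoeff N β ℓ j : ℚ) : ℚ_[2])) :
    red (∑ j ∈ Finset.range (N.factorization ℓ + 1),
        PowerSeries.C (z j * chiMinusFour 2 ℓ ^ j) *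
          PowerSeries.binomialSeries ℤ_[2] (-(frobeniusExponent 2 (ℓ : ℤ_[2]))) ^ j) =
      (red (PowerSeries.binomialSeries ℤ_[2] (-(frobeniusExponent 2 (ℓ : ℤ_[2])))) *
        red (frobeniusSeries 2 ℓ - 1)) ^ N.factorization ℓ := by
  have hℓodd : Odd ℓ := odd_of_mem_primeFactors_odd hodd hℓ
  have hℓ1 : ‖(ℓ : ℚ_[2])‖ = 1 := norm_natCast_eq_one_of_mem_primeFactors_odd hodd hℓ
  have hℓ1' : ‖(ℓ : ℤ_[2])‖ = 1 := by rw [PadicInt.norm_def]; exact_mod_cast hℓ1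
  -- notation
  set γi := red (PowerSeries.binomialSeries ℤ_[2] (-(frobeniusExponent 2 (ℓ : ℤ_[2])))) with hγi
  set γ := red (frobeniusSeries 2 ℓ) with hγ
  have hinv : γi * γ = 1 := by
    rw [hγi, hγ, ← red_mul', binomialSeries_neg_mul_frobeniusSeries]; unfold red; rw [map_one]
  have hγ1 : red (frobeniusSeries 2 ℓ - 1) = γ - 1 := red_sub_one _
  -- residues of the local coefficients
  have hterm : ∀ j, red (PowerSeries.C (z j * chiMinusFour 2 ℓ ^ j) *
      PowerSeries.binomialSeries ℤ_[2] (-(frobeniusExponent 2 (ℓ : ℤ_[2]))) ^ j) =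
      PowerSeries.C (IsLocalRing.residue ℤ_[2] (z j)) * γi ^ j := fun j ↦ by
    rw [red_mul', hγi]
    unfold red
    rw [PowerSeries.map_C, map_mul, residue_chiMinusFour_of_odd hℓodd, mul_one, map_pow]
  have hz_norm : ∀ j, ‖z j‖ = ‖((localStabCoeff N β ℓ j : ℚ) : ℚ_[2])‖ := fun j ↦ by
    rw [PadicInt.norm_def, hz]
  -- `c_ℓ(0) = 1`
  have hz0 : IsLocalRing.residue ℤ_[2] (z 0) = 1 := by
    refine (residue_eq_of_norm _).1 ?_
    rw [hz_norm, localStabCoeff_zero]; push_cast; exact norm_one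
  rcases factorization_eq_one_or_two_of_admissible hadm hℓ with h1 | h2
  · -- `ℓ ∥ N`: `c_ℓ(1) = −β_ℓ/ℓ` is a unit
    have hz1 : IsLocalRing.residue ℤ_[2] (z 1) = 1 := by
      refine (residue_eq_of_norm _).1 ?_
      rw [hz_norm]
      simp only [localStabCoeff, h1, if_true, show (1 : ℕ) ≠ 0 from one_ne_zero, if_false]
      push_cast
      rw [norm_div, norm_neg, hℓ1, div_one]
      rcases hadm.2.1 ℓ hℓ h1 with hb | hb <;> rw [hb] <;> push_cast
      · exact norm_one
      · exact hℓ1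
    rw [h1, Finset.sum_range_succ, Finset.sum_range_succ, Finset.sum_range_zero, zero_add, red_add', hterm 0, hterm 1,
      hz0, hz1, map_one, one_mul, one_mul, pow_zero, pow_one, pow_one, hγ1, mul_sub, hinv, mul_one, sub_eq_add_neg,
      neg_eq_self_powerSeries_residueField_two, add_comm]
  · -- `ℓ² ∥ N`: `c_ℓ(1) = −(1+ℓ)/ℓ` is NOT a unit, `c_ℓ(2) = 1/ℓ` is
    have hz1 : IsLocalRing.residue ℤ_[2] (z 1) = 0 := by
      refine (residue_eq_of_norm _).2 ?_
      rw [hz_norm]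
      simp only [localStabCoeff, h2, show (2 : ℕ) ≠ 1 from by decide, if_false, if_true,
        show (1 : ℕ) ≠ 0 from one_ne_zero]
      push_cast
      rw [norm_div, norm_neg, hℓ1, div_one]
      obtain ⟨k, hk⟩ := hℓodd
      have : (1 : ℚ_[2]) + ℓ = ((2 * (k + 1) : ℤ) : ℚ_[2]) := by rw [hk]; push_cast; ring
      rw [this]
      have h2dvd : (2 ^ 1 : ℤ) ∣ 2 * (k + 1) := ⟨k + 1, by ring⟩
      exact lt_of_le_of_lt ((Padic.norm_int_le_pow_iff_dvd _ 1).mpr h2dvd) (by norm_num)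
    have hz2 : IsLocalRing.residue ℤ_[2] (z 2) = 1 := by
      refine (residue_eq_of_norm _).1 ?_
      rw [hz_norm]
      simp only [localStabCoeff, h2, show (2 : ℕ) ≠ 1 from by decide, if_false, if_true,
        show (2 : ℕ) ≠ 0 from two_ne_zero]
      push_cast
      rw [norm_div, norm_one, hℓ1, div_one]
    rw [h2, Finset.sum_range_succ, Finset.sum_range_succ, Finset.sum_range_succ, Finset.sum_range_zero, zero_add,
      red_add', red_add', hterm 0, hterm 1, hterm 2, hz0, hz1, hz2, map_one, map_zero, one_mul, one_mul, zero_mul,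
      add_zero, pow_zero, hγ1, mul_sub, hinv, mul_one, sub_eq_add_neg, neg_eq_self_powerSeries_residueField_two,
      add_pow_two, mul_one, one_pow, two_eq_zero_powerSeries_residueField_two, zero_mul, add_zero]

/-- **Reduction mod 2 of the level element** `L_Λ = ∑_{t ∣ N} C(c_t χ₋₄(t))·(1+T)^{−f_t} ∈ Λ`:
`red L_Λ = red((1+T)^{e})·∏_{ℓ ∣ N} red(γ_ℓ − 1)^{ord_ℓ N}` with `e = −∑_ℓ ord_ℓ(N)·f_ℓ` (Euler product over the primes of `N`,
then `red_localLevelFactor`). [cite: GreenbergVatsal2000, §3 (28)] [cite: Stevens1982, §5.4 (PDF p. 74)] -/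
theorem red_levelElement (hodd : Odd N) (hadm : IsAdmissibleStabData N β) (z : ℕ → ℤ_[2])
    (hz : ∀ t, (z t : ℚ_[2]) = ((stabCoeff N β t : ℚ) : ℚ_[2])) :
    red (∑ t ∈ N.divisors, PowerSeries.C (z t * chiMinusFour 2 t) *
        PowerSeries.binomialSeries ℤ_[2] (-(frobeniusExponent 2 (t : ℤ_[2])))) =
      red (PowerSeries.binomialSeries ℤ_[2]
          (-(∑ ℓ ∈ N.primeFactors, (N.factorization ℓ : ℤ_[2]) * frobeniusExponent 2 (ℓ : ℤ_[2])))) *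
        ∏ ℓ ∈ N.primeFactors, red (frobeniusSeries 2 ℓ - 1) ^ N.factorization ℓ := by
  have hN : N ≠ 0 := fun h ↦ by simp [h] at hodd
  -- the summand as a multiplicative function
  set F : ℕ → IwasawaAlgebra 2 := fun t ↦ PowerSeries.C (z t * chiMinusFour 2 t) *
    PowerSeries.binomialSeries ℤ_[2] (-(frobeniusExponent 2 (t : ℤ_[2]))) with hF_def
  have hzmul : ∀ m n : ℕ, m ≠ 0 → n ≠ 0 → Nat.Coprime m n → z (m * n) = z m * z n := fun m n hm hn hmn ↦ by
    apply Subtype.ext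
    show (z (m * n) : ℚ_[2]) = ((z m * z n : ℤ_[2]) : ℚ_[2])
    rw [PadicInt.coe_mul, hz, hz, hz, stabCoeff_mul N β hm hn hmn]; push_cast; ring
  have hz1 : z 1 = 1 := by
    apply Subtype.ext
    show (z 1 : ℚ_[2]) = ((1 : ℤ_[2]) : ℚ_[2])
    rw [hz, stabCoeff_one]; push_cast; rfl
  have hχ_even : ∀ m : ℕ, ¬ Odd m → chiMinusFour 2 m = 0 := fun m hm ↦
    chiMinusFour_eq_zero_of_two_dvd 2 (even_iff_two_dvd.mp (Nat.not_odd_iff_even.mp hm))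
  have hF1 : F 1 = 1 := by
    simp only [hF_def, hz1, chiMinusFour_eq_ite, Nat.one_mod, if_true, map_one, frobeniusExponent_one, neg_zero,
      PowerSeries.binomialSeries_zero, mul_one]
  have hFmul : ∀ m n : ℕ, m ≠ 0 → n ≠ 0 → Nat.Coprime m n → F (m * n) = F m * F n := by
    intro m n hm hn hmn
    simp only [hF_def]
    by_cases hmo : Odd m
    · by_cases hno : Odd n
      · rw [hzmul m n hm hn hmn, chiMinusFour_mul, frobeniusExponent_mul_of_odd hmo hno, neg_add,
          PowerSeries.binomialSeries_add]
        simp only [map_mul]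
        ring
      · have h0 : chiMinusFour 2 (m * n) = 0 := hχ_even _ (fun h ↦ hno (Nat.Odd.of_mul_right h))
        rw [h0, hχ_even n hno, mul_zero, mul_zero, map_zero, zero_mul, zero_mul, mul_zero]
    · have h0 : chiMinusFour 2 (m * n) = 0 := hχ_even _ (fun h ↦ hmo (Nat.Odd.of_mul_left h))
      rw [h0, hχ_even m hmo, mul_zero, mul_zero, map_zero, zero_mul, zero_mul, zero_mul]
  have hsum := sum_divisors_eq_prod_primeFactors F hF1 hFmul hN
  rw [show (∑ t ∈ N.divisors, PowerSeries.C (z t * chiMinusFour 2 t) *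
      PowerSeries.binomialSeries ℤ_[2] (-(frobeniusExponent 2 (t : ℤ_[2])))) = ∑ t ∈ N.divisors, F t from rfl, hsum]
  -- prime by prime
  have hloc : ∀ ℓ ∈ N.primeFactors, red (∑ j ∈ Finset.range (N.factorization ℓ + 1), F (ℓ ^ j)) =
      (red (PowerSeries.binomialSeries ℤ_[2] (-(frobeniusExponent 2 (ℓ : ℤ_[2])))) *
        red (frobeniusSeries 2 ℓ - 1)) ^ N.factorization ℓ := by
    intro ℓ hℓ
    have hℓodd : Odd ℓ := odd_of_mem_primeFactors_odd hodd hℓ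
    have hrw : ∀ j, F (ℓ ^ j) = PowerSeries.C (z (ℓ ^ j) * chiMinusFour 2 ℓ ^ j) *
        PowerSeries.binomialSeries ℤ_[2] (-(frobeniusExponent 2 (ℓ : ℤ_[2]))) ^ j := fun j ↦ by
      simp only [hF_def]
      rw [chiMinusFour_pow, frobeniusExponent_pow_of_odd hℓodd, ← smul_neg, binomialSeries_nsmul]
    rw [Finset.sum_congr rfl fun j _ ↦ hrw j]
    exact red_localLevelFactor hodd hadm hℓ (fun j ↦ z (ℓ ^ j)) fun j ↦ by rw [hz, stabCoeff_prime_pow N β hℓ]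
  unfold red at hloc ⊢
  rw [map_prod, Finset.prod_congr rfl hloc, Finset.prod_congr rfl fun x _ ↦ mul_pow _ _ _, Finset.prod_mul_distrib]
  congr 1
  rw [← Finset.sum_neg_distrib, binomialSeries_finset_sum, map_prod]
  refine Finset.prod_congr rfl fun ℓ _ ↦ ?_
  rw [← map_pow, ← binomialSeries_nsmul, smul_neg, nsmul_eq_mul]

end LevelFactor



end Summit.BirchSwinnertonDyer.BirchSwinnertonDyer.Theorems.DepletionAtTwo

end
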